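import Literature.MathematicalPhysics.QuantumFieldTheory.Balaban1983to89.B10SectCExpansion
import Summits.QuantumFields.Balaban3D.Proofs.OldOutsideShells

/-!
# `Balaban3D.Proofs.OldOutsideDropped` — [B10] p. 272 L28–31 from **(44)** p. 267: the per-block sum of the DROPPED
# old terms (those `Y_j = (y₀; c₁, …, c_n)` not contained in Ω_{k+1}) obeys the (45)-bound TIMES the shell factor
# `exp(−½κ₁(M₁Lʲη)⁻¹·dist(y₀, Z_k))` — the hypothesis `hshell` of `OldOutsideShells.oldOutside_of_shells` DERIVED
# from the (α)-display (44) over LQB's literal (43)–(45) carriers (`B10SectCExpansion.VertexGeometry`/`TermSizes`/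
# `Bound44`/`blockSum45`, the carriers of p2's row B15), by LQB's own (44) ⇒ (45) summation at HALF the decay rate

Lane «pub-balaban3d», seat p5; LEAF-LEDGER row C10.  Kernel bookkeeping; no definition, no named fact (the reach property `hreach` is instantiated in the tree by `Run3OldOutside.oldOutside_series` from the explicit distance of `Run3OldOutside.infDist_nonneg` / `infDist_le` / `infDist_eq`; its abstract model distToCompl / reach_of_notSubset is HOME drafts/p5/withdrawn/ReachGeometry.lean, a documentation draft, not in the tree).  Mechanism (the
sentence print does not write, pub-balaban GAPS G-B10-07 (b)): a dropped term has a point outside Ω_{k+1}, hence a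
bond with `|c_{i,−} − y₀| ≥ dist(y₀, Z_k)` (`hreach`, geometry); split each factor `exp(−κ₁(M₁Lʲη)⁻¹|c_{i,−} − y₀|)` of
(44) into two halves, spend one half of that one factor on `exp(−½κ₁(M₁Lʲη)⁻¹dist(y₀, Z_k))` and the other halves on
LQB's (44) ⇒ (45) summation `B10SectCExpansion.bound45_of_bound44` (with the one-bond lattice sum `Z′` at rate ½κ₁ and
the smallness «for g_{k−1} sufficiently small» at `Z′`).

THE PRINTED TEXT (render p013 = p. 267): (44) L4–6 «|𝒫_j(Y_j, U_k)| ≦ O(1) Π_{i=1}^n exp(−κ₁(M₁Lʲη)⁻¹|c_{i,−} − y|) ×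
(Lʲη)⁻¹|c_{i,−} − y|8L²B₃g_{k−1}p(g_{k−1})(Lʲη)².»; (45) L8–10 «By the assumption n ≧ 2, summation over all Y_j with y
fixed yields for g_{k−1} sufficiently small Σ_{Y_j: y = y₀} |𝒫_j(Y_j, U_k)| ≦ O(1)(O(M₁³)g_{k−1}p(g_{k−1}))²(Lʲη)⁴.»;
p. 272 L28–31 «To get the exact inequality we estimate a sum of all terms 𝒫_j(Y_j, U_{k+1}) with localizations Y_j not
contained in Ω_{k+1} by O(1)|Λ_k|, or by O(1)|Z_k|.»

WHAT IS PROVED.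
* `prod_exp_neg_le_one_factor` — `Π_i e^{−a·r_i} ≤ e^{−a·r_{i₀}}` for `a, r_i ≥ 0`.
* `dropped_blockSum_le` — under (44) (rate κ₁, constant C), the degree floor n ≥ 2 of (43), the reach property of the
  dropped terms, the half-rate one-bond sum bound `Z′` and the smallness `8L²B₃Z′·g p(g)·(Lʲη)² ≤ ½`:
  `Σ_{n≤N} Σ_{c} 𝟙[dropped]·|𝒫_j((y₀; c), U_{k+1})| ≤ 2C(8L²B₃Z′·g p(g))²(Lʲη)⁴ · exp(−½κ₁(M₁Lʲη)⁻¹·D(y₀))`, uniformly in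
  the degree cut-off N — LQB `bound45_of_bound44` BY NAME on the reweighted dropped sizes.
* `dropped_blockSum_le_floor` — the same with the shell index `⌊D(y₀)/(M₁Lʲη)⌋` in the exponent (the `dist` of
  `OldOutsideShells`).
* `oldOutside_of_bound44` — **LEAF-LEDGER C10 from row (44) + carrier geometry**: all scales j = 1..k over the literal
  (43)–(45) carriers, composed with `OldOutsideShells.oldOutside_of_shells_finset`:
  `OldOutside P (2C(8L²B₃Z′·g p(g))²·c_sh·S·M₁⁻³·(L/(L−1)))`.
* `abs_pold_sub_poldIn_le` — its `hdiff` when `Pold`/`PoldIn` are the Finset sums of the same signed terms (R-PIECES (d)).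
[cite: Balaban1985UV3, (44)–(45) p.267 + Thm 2 proof p.272]
-/

open Finset
open scoped BigOperators

namespace Summit.QuantumFields.Balaban3D.Proofs

open Literature.MathematicalPhysics.QuantumFieldTheory.Balaban1983to89
open Literature.MathematicalPhysics.QuantumFieldTheory.Balaban1983to89.B10SectCExpansion

/-- `Π_i e^{−a·r_i} ≤ e^{−a·r_{i₀}}` when `a ≥ 0` and all `r_i ≥ 0` (every factor is in (0, 1]). [folklore] -/
theorem prod_exp_neg_le_one_factor {n : ℕ} (r : Fin n → ℝ) {a : ℝ} (ha : 0 ≤ a) (hr : ∀ i, 0 ≤ r i) (i₀ : Fin n) :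
    ∏ i, Real.exp (-(a * r i)) ≤ Real.exp (-(a * r i₀)) := by
  classical
  rw [← Finset.mul_prod_erase Finset.univ (fun i => Real.exp (-(a * r i))) (Finset.mem_univ i₀)]
  have h1 : ∏ i ∈ Finset.univ.erase i₀, Real.exp (-(a * r i)) ≤ 1 :=
    Finset.prod_le_one (fun i _ => (Real.exp_pos _).le) fun i _ =>
      Real.exp_le_one_iff.mpr (by nlinarith [hr i])
  have h0 : 0 ≤ Real.exp (-(a * r i₀)) := (Real.exp_pos _).le
  nlinarith

variable (X : VertexGeometry) (PU : TermSizes X) (adm : X.Site → Finset X.Bond) (N : ℕ)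
  (Drop : X.Site → (n : ℕ) → (Fin n → X.Bond) → Prop) [∀ y n c, Decidable (Drop y n c)] (D : X.Site → ℝ)

/-- **The dropped terms at one block, from (44)**: `PU y n c = |𝒫_j((y; c), U_{k+1})|` obeying (44) at rate κ₁ with
constant `C ≥ 0` and the degree floor of (43); `Drop y n c` = «Y_j not contained in Ω_{k+1}»; `D y` a length such
that every dropped non-zero term has a bond with `|c_{i,−} − y| ≥ D y` (`hreach`: the distance from y to Z_k = Ω_{k+1}ᶜ
in lattice units); `Z′` a bound of the one-bond sum `Σ_{b ∈ adm y} exp(−½κ₁(M₁ℓ)⁻¹|b₋ − y|)·(ℓ⁻¹|b₋ − y|)` and the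
smallness `8L²B₃Z′·g·p(g)·ℓ² ≤ ½` («for g_{k−1} sufficiently small», ℓ = Lʲη).  Then the dropped block sum is at most
`2C(8L²B₃Z′·g p(g))²ℓ⁴ · exp(−½κ₁(M₁ℓ)⁻¹·D y)` for every degree cut-off N.  LQB `B10SectCExpansion.bound45_of_bound44`
applied to the reweighted sizes `𝟙[dropped]·|𝒫|·e^{+½κ₁(M₁ℓ)⁻¹D}`, which still obey (44) at rate ½κ₁.
[cite: Balaban1985UV3, (44)–(45) p.267 + Thm 2 proof p.272] -/
theorem dropped_blockSum_le {κ₁ M₁ ℓ L B₃ g pg C Z' : ℝ} (hC : 0 ≤ C) (hℓ : 0 < ℓ) (hB : 0 ≤ B₃) (hg : 0 ≤ g)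
    (hpg : 0 ≤ pg) (hM : 0 < M₁) (hκ₁ : 0 ≤ κ₁) (hdist : ∀ x y, 0 ≤ X.dist x y)
    (h44 : Bound44 X PU κ₁ M₁ ℓ L B₃ g pg C)
    (hfloor : ∀ (y : X.Site) (n : ℕ) (c : Fin n → X.Bond), PU y n c ≠ 0 → 2 ≤ n)
    (hreach : ∀ (y : X.Site) (n : ℕ) (c : Fin n → X.Bond), Drop y n c → PU y n c ≠ 0 →
      ∃ i, D y ≤ X.dist (X.cminus (c i)) y)
    (hZ' : ∀ y₀ : X.Site, ∑ b ∈ adm y₀,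
      Real.exp (-(κ₁ / 2 * (M₁ * ℓ)⁻¹ * X.dist (X.cminus b) y₀)) * (ℓ⁻¹ * X.dist (X.cminus b) y₀) ≤ Z')
    (hsmall : 8 * L ^ 2 * B₃ * Z' * g * pg * ℓ ^ 2 ≤ 1 / 2) (y₀ : X.Site) :
    ∑ n ∈ Finset.range (N + 1), ∑ c ∈ Fintype.piFinset (fun _ : Fin n => adm y₀),
        (if Drop y₀ n c then |PU y₀ n c| else 0)
      ≤ 2 * C * ((8 * L ^ 2 * B₃ * Z') * g * pg) ^ 2 * ℓ ^ 4 * Real.exp (-(κ₁ / 2 * (M₁ * ℓ)⁻¹ * D y₀)) := by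
  classical
  -- the half-rate weight a = ½κ₁(M₁ℓ)⁻¹ ≥ 0
  set a : ℝ := κ₁ / 2 * (M₁ * ℓ)⁻¹ with ha_def
  have ha : 0 ≤ a := by rw [ha_def]; positivity
  -- reweighted dropped sizes
  let PU' : TermSizes X := fun y n c => if Drop y n c then PU y n c * Real.exp (a * D y) else 0
  -- (44) at rate κ₁/2 for PU'
  have hfac : ∀ (y : X.Site) (b : X.Bond), factor44 X κ₁ M₁ ℓ L B₃ g pg y b =
      factor44 X (κ₁ / 2) M₁ ℓ L B₃ g pg y b * Real.exp (-(a * X.dist (X.cminus b) y)) := by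
    intro y b
    unfold factor44
    rw [ha_def]
    have : Real.exp (-(κ₁ * (M₁ * ℓ)⁻¹ * X.dist (X.cminus b) y)) =
        Real.exp (-(κ₁ / 2 * (M₁ * ℓ)⁻¹ * X.dist (X.cminus b) y)) *
          Real.exp (-(κ₁ / 2 * (M₁ * ℓ)⁻¹ * X.dist (X.cminus b) y)) := by
      rw [← Real.exp_add]; ring_nf
    rw [this]; ring
  have hf0 : ∀ (y : X.Site) (b : X.Bond), 0 ≤ factor44 X (κ₁ / 2) M₁ ℓ L B₃ g pg y b :=
    factor44_nonneg X hℓ hB hg hpg hdist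
  have h44' : Bound44 X PU' (κ₁ / 2) M₁ ℓ L B₃ g pg C := by
    rw [bound44_iff_factor44]
    intro y n c
    have hprod0 : 0 ≤ C * ∏ i, factor44 X (κ₁ / 2) M₁ ℓ L B₃ g pg y (c i) :=
      mul_nonneg hC (Finset.prod_nonneg fun i _ => hf0 y (c i))
    by_cases hd : Drop y n c
    · by_cases hP : PU y n c = 0
      · simp only [PU', hd, if_true, hP, zero_mul, abs_zero]
        exact hprod0
      · obtain ⟨i₀, hi₀⟩ := hreach y n c hd hP
        have h1 := (bound44_iff_factor44 X PU κ₁ M₁ ℓ L B₃ g pg C).1 h44 y n c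
        simp only [PU', hd, if_true]
        rw [abs_mul, abs_of_pos (Real.exp_pos _)]
        -- Π factor44 κ₁ = Π factor44 (κ₁/2) · Π e^{-a r_i} ≤ Π factor44 (κ₁/2) · e^{-a D}
        have hsplit : ∏ i, factor44 X κ₁ M₁ ℓ L B₃ g pg y (c i) =
            (∏ i, factor44 X (κ₁ / 2) M₁ ℓ L B₃ g pg y (c i)) *
              ∏ i, Real.exp (-(a * X.dist (X.cminus (c i)) y)) := by
          rw [← Finset.prod_mul_distrib]
          exact Finset.prod_congr rfl fun i _ => hfac y (c i)
        have hone : ∏ i, Real.exp (-(a * X.dist (X.cminus (c i)) y)) ≤ Real.exp (-(a * D y)) :=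
          (prod_exp_neg_le_one_factor (fun i => X.dist (X.cminus (c i)) y) ha (fun i => hdist _ _) i₀).trans
            (Real.exp_le_exp.mpr (by nlinarith))
        have hP0 : 0 ≤ ∏ i, factor44 X (κ₁ / 2) M₁ ℓ L B₃ g pg y (c i) :=
          Finset.prod_nonneg fun i _ => hf0 y (c i)
        calc |PU y n c| * Real.exp (a * D y)
            ≤ (C * ∏ i, factor44 X κ₁ M₁ ℓ L B₃ g pg y (c i)) * Real.exp (a * D y) :=
              mul_le_mul_of_nonneg_right h1 (Real.exp_pos _).le
          _ = C * (∏ i, factor44 X (κ₁ / 2) M₁ ℓ L B₃ g pg y (c i)) *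
                ((∏ i, Real.exp (-(a * X.dist (X.cminus (c i)) y))) * Real.exp (a * D y)) := by
              rw [hsplit]; ring
          _ ≤ C * (∏ i, factor44 X (κ₁ / 2) M₁ ℓ L B₃ g pg y (c i)) * (Real.exp (-(a * D y)) * Real.exp (a * D y)) :=
              mul_le_mul_of_nonneg_left (mul_le_mul_of_nonneg_right hone (Real.exp_pos _).le) (mul_nonneg hC hP0)
          _ = C * ∏ i, factor44 X (κ₁ / 2) M₁ ℓ L B₃ g pg y (c i) := by
              rw [← Real.exp_add, neg_add_cancel, Real.exp_zero, mul_one]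
    · simp only [PU', hd, if_false, abs_zero]
      exact hprod0
  have hfloor' : ∀ (y : X.Site) (n : ℕ) (c : Fin n → X.Bond), PU' y n c ≠ 0 → 2 ≤ n := by
    intro y n c hne
    by_cases hd : Drop y n c
    · refine hfloor y n c fun hP => hne ?_
      simp only [PU', hd, if_true, hP, zero_mul]
    · exact absurd (by simp only [PU', hd, if_false]) hne
  -- LQB (44) ⇒ (45) at half rate
  have h45 := bound45_of_bound44 X PU' adm N hC hℓ hB hg hpg hdist h44' hfloor' hZ' hsmall y₀
  -- blockSum45 of PU' is e^{aD} times the dropped sum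
  have hblock : blockSum45 X PU' adm N y₀ = Real.exp (a * D y₀) *
      ∑ n ∈ Finset.range (N + 1), ∑ c ∈ Fintype.piFinset (fun _ : Fin n => adm y₀),
        (if Drop y₀ n c then |PU y₀ n c| else 0) := by
    unfold blockSum45
    rw [Finset.mul_sum]
    refine Finset.sum_congr rfl fun n _ => ?_
    rw [Finset.mul_sum]
    refine Finset.sum_congr rfl fun c _ => ?_
    by_cases hd : Drop y₀ n c
    · simp only [PU', hd, if_true, abs_mul, abs_of_pos (Real.exp_pos _)]; ring
    · simp only [PU', hd, if_false, abs_zero, mul_zero]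
  rw [hblock] at h45
  have hexp : 0 < Real.exp (a * D y₀) := Real.exp_pos _
  rw [mul_comm] at h45
  rw [← le_div_iff₀ hexp] at h45
  refine h45.trans (le_of_eq ?_)
  rw [div_eq_mul_inv, ← Real.exp_neg, ha_def]

/-- The same with the SHELL INDEX `⌊D(y₀)/(M₁ℓ)⌋` (the number of whole scale-j big-block widths between y₀ and Z_k) in
the exponent: `… ≤ 2C(8L²B₃Z′·g p(g))²ℓ⁴ · exp(−½κ₁·⌊D y₀/(M₁ℓ)⌋)` — the hypothesis `hshell` of
`OldOutsideShells.oldOutside_of_shells` with `A₀ = 2C(8L²B₃Z′·g p(g))²`, `κ = ½κ₁`, `dist = ⌊D/(M₁ℓ)⌋`.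
[cite: Balaban1985UV3, (44)–(45) p.267 + Thm 2 proof p.272] -/
theorem dropped_blockSum_le_floor {κ₁ M₁ ℓ L B₃ g pg C Z' : ℝ} (hC : 0 ≤ C) (hℓ : 0 < ℓ) (hB : 0 ≤ B₃) (hg : 0 ≤ g)
    (hpg : 0 ≤ pg) (hM : 0 < M₁) (hκ₁ : 0 ≤ κ₁) (hdist : ∀ x y, 0 ≤ X.dist x y) (hD : ∀ y, 0 ≤ D y)
    (h44 : Bound44 X PU κ₁ M₁ ℓ L B₃ g pg C)
    (hfloor : ∀ (y : X.Site) (n : ℕ) (c : Fin n → X.Bond), PU y n c ≠ 0 → 2 ≤ n)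
    (hreach : ∀ (y : X.Site) (n : ℕ) (c : Fin n → X.Bond), Drop y n c → PU y n c ≠ 0 →
      ∃ i, D y ≤ X.dist (X.cminus (c i)) y)
    (hZ' : ∀ y₀ : X.Site, ∑ b ∈ adm y₀,
      Real.exp (-(κ₁ / 2 * (M₁ * ℓ)⁻¹ * X.dist (X.cminus b) y₀)) * (ℓ⁻¹ * X.dist (X.cminus b) y₀) ≤ Z')
    (hsmall : 8 * L ^ 2 * B₃ * Z' * g * pg * ℓ ^ 2 ≤ 1 / 2) (y₀ : X.Site) :
    ∑ n ∈ Finset.range (N + 1), ∑ c ∈ Fintype.piFinset (fun _ : Fin n => adm y₀),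
        (if Drop y₀ n c then |PU y₀ n c| else 0)
      ≤ 2 * C * ((8 * L ^ 2 * B₃ * Z') * g * pg) ^ 2 * ℓ ^ 4 *
          Real.exp (-(κ₁ / 2 * (⌊D y₀ / (M₁ * ℓ)⌋₊ : ℕ))) := by
  refine (dropped_blockSum_le X PU adm N Drop D hC hℓ hB hg hpg hM hκ₁ hdist h44 hfloor hreach hZ' hsmall
    y₀).trans ?_
  have hK : 0 ≤ 2 * C * ((8 * L ^ 2 * B₃ * Z') * g * pg) ^ 2 * ℓ ^ 4 := by positivity
  refine mul_le_mul_of_nonneg_left (Real.exp_le_exp.mpr ?_) hK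
  have hMl : 0 < M₁ * ℓ := mul_pos hM hℓ
  have hfl : ((⌊D y₀ / (M₁ * ℓ)⌋₊ : ℕ) : ℝ) ≤ D y₀ / (M₁ * ℓ) := Nat.floor_le (div_nonneg (hD y₀) hMl.le)
  have : (M₁ * ℓ)⁻¹ * D y₀ = D y₀ / (M₁ * ℓ) := by rw [div_eq_inv_mul]
  nlinarith [this]

/-! ## All scales: `OldOutside` from (44) -/

section AllScales

open Literature.MathematicalPhysics.QuantumFieldTheory.Balaban1983to89.B10 (TowerRun)
open Literature.MathematicalPhysics.QuantumFieldTheory.Balaban1983to89.B10SectAGathering (StepPieces OldOutside)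

variable {T : TowerRun} {k : ℕ}

/-- **LEAF-LEDGER C10 from row (44) and the carrier's geometry** (p. 272 L28–31 with a k-uniform O(1)).  Per scale
`j = 1..k`: the literal (43)–(45) carrier `X j` (sites = big blocks of the Lʲη-lattice, bonds), per history/field the
term sizes `PU h U j` = |𝒫_j(Y_j, U_{k+1})| with **(44)** (`h44`, rate κ₁, constant C — the (α) display of row (44),
the SAME hypothesis as LEAF-LEDGER B15), the degree floor of (43), the admissible bonds `adm h j y`, degree cut-offs
`N j`, the dropped-term predicate `Drop h j` («Y_j not contained in Ω_{k+1}») with its reach length `D h j y ≥ 0`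
(`hreach`: a dropped term has a bond at distance ≥ D from y; D = dist(y, Z_k)), the block sets `blocks h j` carrying
the old terms with the shell count `hcount` (blocks within m shells of Z_k ≤ c_sh(m+1)³·(M₁Lʲη)⁻³|Z_k|), the
half-rate one-bond sum `Z′` with the smallness `8L²B₃Z′·g p(g)·(Lʲη)² ≤ ½`, the definitional `hdiff` (|Pold − PoldIn| ≤
the sum of the dropped sizes), `Lʲη = L^{j−k}`, and the shell-series majorant `S` (`shell_series_le`): then
`OldOutside P (2C(8L²B₃Z′·g·p(g))²·c_sh·S·M₁⁻³·(L/(L−1)))` — k- and ε-independent.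
[cite: Balaban1985UV3, Thm 2 proof p.272 + (44)–(46) p.267] -/
theorem oldOutside_of_bound44 (P : StepPieces T k) (Xg : ℕ → VertexGeometry)
    (PU : T.Hist (k + 1) → T.Cfg (k + 1) → (j : ℕ) → TermSizes (Xg j))
    (adm : T.Hist (k + 1) → (j : ℕ) → (Xg j).Site → Finset (Xg j).Bond) (Ndeg : ℕ → ℕ)
    (Drop : T.Hist (k + 1) → (j : ℕ) → (Xg j).Site → (n : ℕ) → (Fin n → (Xg j).Bond) → Prop)
    [∀ h j y n c, Decidable (Drop h j y n c)]
    (D : T.Hist (k + 1) → (j : ℕ) → (Xg j).Site → ℝ)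
    (blocks : T.Hist (k + 1) → (j : ℕ) → Finset (Xg j).Site) (ℓ : ℕ → ℝ)
    {κ₁ M₁ L B₃ g pg C Z' csh S : ℝ} (hC : 0 ≤ C) (hB : 0 ≤ B₃) (hg : 0 ≤ g) (hpg : 0 ≤ pg) (hM : 0 < M₁)
    (hκ₁ : 0 ≤ κ₁) (hL : 1 < L) (hcsh : 0 ≤ csh) (hS0 : 0 ≤ S)
    (hℓ : ∀ j ∈ Finset.Icc 1 k, ℓ j = L⁻¹ ^ (k - j))
    (hdist : ∀ j, ∀ x y : (Xg j).Site, 0 ≤ (Xg j).dist x y) (hD : ∀ h j y, 0 ≤ D h j y)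
    (h44 : ∀ (h : T.Hist (k + 1)) (U : T.Cfg (k + 1)), ∀ j ∈ Finset.Icc 1 k,
      Bound44 (Xg j) (PU h U j) κ₁ M₁ (ℓ j) L B₃ g pg C)
    (hfloor : ∀ (h : T.Hist (k + 1)) (U : T.Cfg (k + 1)), ∀ j ∈ Finset.Icc 1 k, ∀ (y : (Xg j).Site) (n : ℕ)
      (c : Fin n → (Xg j).Bond), PU h U j y n c ≠ 0 → 2 ≤ n)
    (hreach : ∀ (h : T.Hist (k + 1)) (U : T.Cfg (k + 1)), ∀ j ∈ Finset.Icc 1 k, ∀ (y : (Xg j).Site) (n : ℕ)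
      (c : Fin n → (Xg j).Bond), Drop h j y n c → PU h U j y n c ≠ 0 →
        ∃ i, D h j y ≤ (Xg j).dist ((Xg j).cminus (c i)) y)
    (hZ' : ∀ (h : T.Hist (k + 1)), ∀ j ∈ Finset.Icc 1 k, ∀ y₀ : (Xg j).Site, ∑ b ∈ adm h j y₀,
      Real.exp (-(κ₁ / 2 * (M₁ * ℓ j)⁻¹ * (Xg j).dist ((Xg j).cminus b) y₀))
        * ((ℓ j)⁻¹ * (Xg j).dist ((Xg j).cminus b) y₀) ≤ Z')
    (hsmall : ∀ j ∈ Finset.Icc 1 k, 8 * L ^ 2 * B₃ * Z' * g * pg * ℓ j ^ 2 ≤ 1 / 2)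
    (hdiff : ∀ (h : T.Hist (k + 1)) (U : T.Cfg (k + 1)), |P.Pold h U - P.PoldIn h U| ≤
      ∑ j ∈ Finset.Icc 1 k, ∑ y ∈ blocks h j, ∑ n ∈ Finset.range (Ndeg j + 1),
        ∑ c ∈ Fintype.piFinset (fun _ : Fin n => adm h j y), (if Drop h j y n c then |PU h U j y n c| else 0))
    (hcount : ∀ (h : T.Hist (k + 1)), ∀ j ∈ Finset.Icc 1 k, ∀ m : ℕ,
      (((blocks h j).filter fun y => ⌊D h j y / (M₁ * ℓ j)⌋₊ ≤ m).card : ℝ)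
        ≤ csh * ((m : ℝ) + 1) ^ 3 * ((M₁ * ℓ j)⁻¹ ^ 3 * P.Zvol h))
    (hS : ∀ M : ℕ, ∑ m ∈ Finset.range M, ((m : ℝ) + 1) ^ 3 * Real.exp (-(κ₁ / 2 * m)) ≤ S) :
    OldOutside P (2 * C * ((8 * L ^ 2 * B₃ * Z') * g * pg) ^ 2 * csh * S * M₁⁻¹ ^ 3 * (L / (L - 1))) := by
  have hL0 : 0 < L := by linarith
  refine oldOutside_of_shells_finset P (fun j => (Xg j).Site) blocks
    (fun h U j y => ∑ n ∈ Finset.range (Ndeg j + 1),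
      ∑ c ∈ Fintype.piFinset (fun _ : Fin n => adm h j y), (if Drop h j y n c then |PU h U j y n c| else 0))
    (fun h j y => ⌊D h j y / (M₁ * ℓ j)⌋₊) ℓ hL hM (by positivity) hcsh hS0 hℓ hdiff ?_ hcount hS
  intro h U j hj y _
  have hℓpos : 0 < ℓ j := by rw [hℓ j hj]; positivity
  exact dropped_blockSum_le_floor (Xg j) (PU h U j) (adm h j) (Ndeg j) (Drop h j) (D h j) hC hℓpos hB hg hpg hM
    hκ₁ (hdist j) (hD h j) (h44 h U j hj) (hfloor h U j hj) (hreach h U j hj) (hZ' h j hj) (hsmall j hj) y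

/-- **The definitional `hdiff`** (R-PIECES (d): `Pold`/`PoldIn` are Finset sums of the SAME signed terms): if
`Pold h U = Σ_j Σ_{y ∈ blocks h j} Σ_{n ≤ N_j} Σ_{c} val` (all old terms) and `PoldIn h U` is the same sum with the dropped
terms («Y_j not contained in Ω_{k+1}») replaced by 0, then `|Pold − PoldIn| ≤ Σ … 𝟙[Drop]·|val|` — the triangle
inequality, so `oldOutside_of_bound44`'s `hdiff` holds with `PU := |val|`-sizes. [folklore] -/
theorem abs_pold_sub_poldIn_le (P : StepPieces T k) (Xg : ℕ → VertexGeometry)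
    (val : T.Hist (k + 1) → T.Cfg (k + 1) → (j : ℕ) → (Xg j).Site → (n : ℕ) → (Fin n → (Xg j).Bond) → ℝ)
    (adm : T.Hist (k + 1) → (j : ℕ) → (Xg j).Site → Finset (Xg j).Bond) (Ndeg : ℕ → ℕ)
    (Drop : T.Hist (k + 1) → (j : ℕ) → (Xg j).Site → (n : ℕ) → (Fin n → (Xg j).Bond) → Prop)
    [∀ h j y n c, Decidable (Drop h j y n c)]
    (blocks : T.Hist (k + 1) → (j : ℕ) → Finset (Xg j).Site)
    (hPold : ∀ (h : T.Hist (k + 1)) (U : T.Cfg (k + 1)), P.Pold h U =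
      ∑ j ∈ Finset.Icc 1 k, ∑ y ∈ blocks h j, ∑ n ∈ Finset.range (Ndeg j + 1),
        ∑ c ∈ Fintype.piFinset (fun _ : Fin n => adm h j y), val h U j y n c)
    (hPoldIn : ∀ (h : T.Hist (k + 1)) (U : T.Cfg (k + 1)), P.PoldIn h U =
      ∑ j ∈ Finset.Icc 1 k, ∑ y ∈ blocks h j, ∑ n ∈ Finset.range (Ndeg j + 1),
        ∑ c ∈ Fintype.piFinset (fun _ : Fin n => adm h j y), (if Drop h j y n c then 0 else val h U j y n c))
    (h : T.Hist (k + 1)) (U : T.Cfg (k + 1)) :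
    |P.Pold h U - P.PoldIn h U| ≤
      ∑ j ∈ Finset.Icc 1 k, ∑ y ∈ blocks h j, ∑ n ∈ Finset.range (Ndeg j + 1),
        ∑ c ∈ Fintype.piFinset (fun _ : Fin n => adm h j y),
          (if Drop h j y n c then |(|val h U j y n c|)| else 0) := by
  rw [hPold h U, hPoldIn h U, ← Finset.sum_sub_distrib]
  refine (Finset.abs_sum_le_sum_abs _ _).trans (Finset.sum_le_sum fun j _ => ?_)
  rw [← Finset.sum_sub_distrib]
  refine (Finset.abs_sum_le_sum_abs _ _).trans (Finset.sum_le_sum fun y _ => ?_)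
  rw [← Finset.sum_sub_distrib]
  refine (Finset.abs_sum_le_sum_abs _ _).trans (Finset.sum_le_sum fun n _ => ?_)
  rw [← Finset.sum_sub_distrib]
  refine (Finset.abs_sum_le_sum_abs _ _).trans (Finset.sum_le_sum fun c _ => ?_)
  by_cases hd : Drop h j y n c <;> simp [hd]

end AllScales

end Summit.QuantumFields.Balaban3D.Proofs
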